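import Summits.QuantumFields.YangMills.Theorems.AllWindowsColdBoxBoxHighWindowsSU22LineDefs

/-!
# LINE-19 / LINE-20 re-cut of the transfer target: the BULK relative comparison `LandauRelativeComparisonBulk` and its currency

Planner ym-idea-2 g18, 2026-08-29.  The registered S5 (`stub_landauSecondOrder`, LINE-19) and U5 (`stub_landauThirdOrder`, LINE-20) conclude
`LandauRelativeComparison θL`, which asks the one-sided relative bound `η·boxDirCircSqCov H T ≤ β²·boxPlaqCov β H T` at EVERY separation
`T ≤ H = ⌈β^θ⌉` — including the wall layer `T ∈ (H − H^{1/2+o(1)}, H]`, where the Dirichlet main term is image-suppressed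
(`boxDirichletPlaqCov H T ≍ T⁻⁴·(H−T+1)/T`) below the absolute precision `β⁻³·H⁴·polylog` that a second-order expansion with a crude
third-order remainder delivers (relative error would need wall-sensitive two-loop kernel asymptotics that no consumer uses).  The ONLY consumer,
the landed currency `AllWindowsColdBox.boxTwoPointDomination_of_relDir_at` (✓p706506), evaluates the bound at `T = ⌈β^A⌉` with `A < θ`,
i.e. at `T/H → 0`.  This file therefore types the BULK form of the transfer target — the bound for `L ≤ T ≤ H/M` with the method's own
constants `M, L` — and proves, sorry-free, that it is booked by the same currency: `boxWindow_of_dirichletDominationBulk_ceiling`.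
Skeletons v12 (LINE-19) / v4 (LINE-20) re-cut S5/U5 to conclude `LandauRelativeComparisonBulk θL` and compose through this theorem.

HONEST LABEL: bookkeeping (a definition and a 40-line exponent computation); proves no comparison, no crux, no rung; the Yang–Mills mass gap
is NOT proved by this file.
-/

set_option autoImplicit false

noncomputable section

open MeasureTheory Real
open Literature.MathematicalPhysics.QuantumLattice
open Summit.QuantumFields.YangMills.Theorems.WeakCouplingRates
open Summit.QuantumFields.YangMills.Theorems.AllWindowsColdBox

namespace Summit.QuantumFields.YangMills.Theorems.AllWindowsColdBoxBoxHighLine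

/-- **The BULK relative Dirichlet comparison up to the ceiling `θL`.**  For every `0 < θ ≤ θL` there are constants `M ≥ 1`, `L`, `η > 0`
and `β₀` such that for `β ≥ β₀` and every BULK separation `T` (`L ≤ T`, `M·T ≤ ⌈β^θ⌉`):
`η · boxDirCircSqCov ⌈β^θ⌉ T ≤ β² · boxPlaqCov (fundamentalRep (Fin 2)) β ⌈β^θ⌉ T`.  (The all-`T` form `LandauRelativeComparison θL` implies it
with `M = L = 1`.) -/
def LandauRelativeComparisonBulk (θL : ℝ) : Prop :=
  ∀ θ : ℝ, 0 < θ → θ ≤ θL → ∃ M L η β₀ : ℝ, 1 ≤ M ∧ 0 < η ∧ ∀ β : ℝ, β₀ ≤ β → ∀ T : ℕ, L ≤ (T : ℝ) → M * (T : ℝ) ≤ (⌈β ^ θ⌉₊ : ℝ) →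
    η * boxDirCircSqCov ⌈β ^ θ⌉₊ T ≤ β ^ 2 * boxPlaqCov (G := SU2) (Literature.MathematicalPhysics.QuantumLattice.fundamentalRep (Fin 2)) β ⌈β ^ θ⌉₊ T

/-- The bulk currency as a Prop (shape of `RelativeCurrency` with the bulk hypothesis). -/
def RelativeCurrencyBulk : Prop :=
  ∀ θc : ℝ, LandauRelativeComparisonBulk θc →
    ∀ A θ : ℝ, 0 < A → A < θ → θ ≤ θc → ∃ c : ℝ, 0 < c ∧ BoxTwoPointDomination (G := SU2) (Literature.MathematicalPhysics.QuantumLattice.fundamentalRep (Fin 2)) A θ c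

/-- The all-`T` transfer target implies the bulk one (with `M = 1`, `L = 0`). -/
theorem landauRelativeComparisonBulk_of_all (θL : ℝ) (h : LandauRelativeComparison θL) : LandauRelativeComparisonBulk θL := by
  intro θ hθ hθL
  obtain ⟨η, hη, β₀, h₀⟩ := h θ hθ hθL
  refine ⟨1, 0, η, β₀, le_rfl, hη, fun β hβ T _hL hT => h₀ β hβ T ?_⟩
  exact_mod_cast (show ((T : ℕ) : ℝ) ≤ (⌈β ^ θ⌉₊ : ℝ) by simpa using hT)

/-- **The bulk relative sandwich at an arbitrary ceiling `θc`** (cold-wall `SU(2)` box, fundamental representation): the bulk comparison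
`LandauRelativeComparisonBulk θc` gives `BoxTwoPointDomination (fundamentalRep (Fin 2)) A θ c` for all `0 < A < θ ≤ θc`, because the currency
`boxTwoPointDomination_of_relDir_at` only evaluates the comparison at `T = ⌈β^A⌉`, and `L ≤ ⌈β^A⌉`, `M·⌈β^A⌉ ≤ 2M·β^A ≤ β^θ ≤ ⌈β^θ⌉` eventually. -/
theorem boxWindow_of_dirichletDominationBulk_ceiling : RelativeCurrencyBulk := by
  intro θc h A θ hA hAθ hθc
  have hθ : 0 < θ := hA.trans hAθ
  have hθA : 0 < θ - A := by linarith
  obtain ⟨M, L, η, β₀, hM1, hη, h₀⟩ := h θ hθ hθc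
  refine boxTwoPointDomination_of_relDir_at (Literature.MathematicalPhysics.QuantumLattice.fundamentalRep (Fin 2)) hη hA hAθ
    ⟨max (max β₀ 1) (max ((2 * M) ^ (1 / (θ - A))) ((max L 1) ^ (1 / A))), fun β hβ => ?_⟩
  have hβ₀ : β₀ ≤ β := le_trans (le_trans (le_max_left _ _) (le_max_left _ _)) hβ
  have hβ1 : 1 ≤ β := le_trans (le_trans (le_max_right _ _) (le_max_left _ _)) hβ
  have hβ0 : 0 ≤ β := by linarith
  have hL1 : 1 ≤ max L 1 := le_max_right _ _
  have hdiff : 2 * M ≤ β ^ (θ - A) :=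
    le_rpow_of_root_le (by positivity) hθA (le_trans (le_trans (le_max_left _ _) (le_max_right _ _)) hβ)
  have hApow : max L 1 ≤ β ^ A :=
    le_rpow_of_root_le (by positivity) hA (le_trans (le_trans (le_max_right _ _) (le_max_right _ _)) hβ)
  have hA1 : 1 ≤ β ^ A := hL1.trans hApow
  have hsplit : β ^ θ = β ^ (θ - A) * β ^ A := by
    rw [← Real.rpow_add (by linarith)]; ring_nf
  have hT_ge : β ^ A ≤ (⌈β ^ A⌉₊ : ℝ) := Nat.le_ceil _
  have hT_lt : (⌈β ^ A⌉₊ : ℝ) < β ^ A + 1 := Nat.ceil_lt_add_one (by positivity)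
  have hT_le : (⌈β ^ A⌉₊ : ℝ) ≤ 2 * β ^ A := by linarith
  have hH_ge : β ^ θ ≤ (⌈β ^ θ⌉₊ : ℝ) := Nat.le_ceil _
  refine h₀ β hβ₀ ⌈β ^ A⌉₊ ((le_max_left _ _).trans (hApow.trans hT_ge)) ?_
  have h1 : M * (⌈β ^ A⌉₊ : ℝ) ≤ M * (2 * β ^ A) := mul_le_mul_of_nonneg_left hT_le (by linarith)
  have h2 : 2 * M * β ^ A ≤ β ^ (θ - A) * β ^ A := mul_le_mul_of_nonneg_right hdiff (by linarith)
  rw [← hsplit] at h2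
  linarith

end Summit.QuantumFields.YangMills.Theorems.AllWindowsColdBoxBoxHighLine

end
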